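import Summits.QuantumFields.YangMills.Theorems.BalabanUVNodesN16AtTupleReading13Sep
import Summits.QuantumFields.YangMills.Theorems.BalabanUVNodesN16HolderMSSlotWindow
import Summits.QuantumFields.YangMills.Theorems.BalabanUVNodesRateReadingOfRecord13Sep

/-!
# Route «BalabanUVNodes», cluster K4 «SpineRates» — node N16 = NE3: THE R-β″ CONJUNCT IN THE K3⁗ SKELETON's OWN CURRENCY (⁗ edition, Record13Sep) — for a TUPLE reading
# `rr` over the separated proviso pinned at RR-1's NE3 object of record, the MS β-conjunct «`∀ F θ hP, (Rg F θ →) θ.Admissible F N → ∀ g₀ os, N16HolderMSAt (rr …).ne3 β`» is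
# ONE `N16HolderMSAt` per family; N21's MS-face; MS ⇒ β at the tuple reading; ★ THE MS N16 LINE in the skeleton's currency (generic `rr` and the LEVEL-SELECTED tuple reading of
# dag-n22-e's ⁗ reading of record `rateCarriersOfRecord₁₃Sep (readingOfRecord₁₃Sep w1 ℓ₃ ne2 ne1) · · · · · (ksel …)`)

⁗ EDITION (Record13Sep re-key, 2026-08-27): director-ym №136–№139 ⇒ node00-def-T `Node00/Record13.lean` v1.2 (p501191) minted `Stage13Params.Provisos₁₃Sep`; dag-n22-e g6's
(T-RATE) layer-B twins (`RateReading₁₃Sep`, `rateCarriersOfRecord₁₃Sep`, `readingOfRecord₁₃Sep`, …) and plan's rev 18 (K3⁗ `SpineGivenEndpointR13Sep` = stmt-QuantumFields-20292,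
dag-lead WORDS-140) followed.  This module has NO ‴ original: it is the R-β″ (multi-scale Hölder) companion of module 21Sep `…N16AtTupleReading13Sep` §3 (which carries the β = 1
and R-β currencies), typed directly over the separated proviso.

Cell `pub-ymgap`, seat `pub-ymgap-dag-n16-e` (R134 acceleration seat (a), strategy s2 = BY-NAME KNIT at the record; HUMAN RULING D-0062; chair R424 venue), generation 6,
module 29Sep (THEOREMS ONLY, 0 `def`, 0 `sorry`).  `--kind proof --supports stmt-QuantumFields-20292 --as helper`.  `bears_on: R4∕N16 · edge N05 → N16 · out-edge N16 → N21`.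
Over module 21Sep (`n16_tupleReading(On)_iff_of_constLayer` pattern), this seat's (F2-MS) `…N16HolderMSSlotWindow` (the STAGE-FREE per-family lemma
`inEndRegimeHMS_and_leafSlotHolderMS_ofRecord_of_window_linear`), (E2-MS) `…N16HolderMSLeafSlot` (closer `n16HolderMSAt_of_inEndRegimeHMS_leafSlotHolderMS`), dag-n16-c's
`…N16HolderMSDefs` (`N16HolderMSAt`, `n16HolderAt_of_n16HolderMSAt`) and dag-n22-e's 6″⁗ `…RateReadingOfRecord13Sep` (`readingOfRecord₁₃Sep`, face `readingOfRecord₁₃Sep_ne3OfRecord`).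

CONTENT.
§1 `hpin`-GENERIC (any tuple reading pinned at RR-1's object with letters `ℓ F`) — `n16HolderMS_tupleReading_iff_ofRecord`, `n16HolderMS_tupleReadingOn_iff_ofRecord`,
  `covRootHolderMS_tupleReading_ofRecord` (N21's MS-face: the `h` of dag-n16-c's `closeness_of_covRootHolderMS`), `n16Holder_tupleReading_of_n16HolderMS` (MS ⇒ β, block factor RR-1's),
  ★ `n16HolderMS_tupleReading_ofRecord_of_window_linear` ∕ `n16HolderMS_tupleReadingOn_ofRecord_of_window_linear` (THE MS N16 LINE: N05's `Thm4Body` ∕ `Prop3Body` on the univ sub-family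
  of `zdGF3 (M_N ℂ) F.L β (len F)` with the MS length letter `len F (j • e μ) = j` + N07's `LeafH3sup`, once per family carrying an admissible (guarded) tuple; thresholds
  `radiusOfRecordHMS` ∕ `constOfRecordHMS`).
§2 AT THE LEVEL-SELECTED TUPLE READING OF dag-n22-e's ⁗ READING OF RECORD (`w1`∕`ne2`∕`ne1`∕`ksel` generic, every `hpin := rfl`) — `n16HolderMS_tupleReadingOfRecordSep_iff`,
  `n16HolderMS_tupleReadingOfRecordSepOn_iff`, ★ `n16HolderMS_tupleReadingOfRecordSepOn_of_window_linear`.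

HONEST FRAMING.  Kernel bookkeeping by name; no estimate; N05's `Thm4Body` ∕ `Prop3Body` and N07's `LeafH3sup` are HYPOTHESES asserted for no family; `N16HolderMSAt · β` is
dag-n16-c's CANDIDATE wording for R-β″ (UNRULED; nothing of record edited); the tuple reading ∕ `w1` ∕ `ne2` ∕ `ne1` ∕ `ksel` are PARAMETERS ∕ residual DATA; no admissible Stage-13
tuple with the separated proviso is claimed to exist (K0⁗ `Record13SepInhabited`, stmt-QuantumFields-20289, OPEN); nothing of Bałaban's asserted; **N16 ∕ NE3 is NOT discharged**;
count-neutral (typed 28∕28 · discharged 5∕27, A 5∕28 UNMOVED); one finite four-torus at fixed ε — NOT ℝ⁴, NOT infinite volume, NOT OS, NOT a mass gap, NOT Clay.  No decl below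
carries a cite tag (all `[folklore]` bookkeeping).
-/

set_option autoImplicit false

open scoped BigOperators Matrix Matrix.Norms.L2Operator
open NormedSpace

namespace Summit.QuantumFields.YangMills.BalabanUVNodes.N16HolderMSAtTupleReading13Sep

open Literature.MathematicalPhysics.QuantumFieldTheory.Balaban1983to89
open Literature.MathematicalPhysics.QuantumFieldTheory.Balaban1983to89.T4Continuum (T4Family ULoop)
open B7Prop1Explicit B7Prop2Explicit
open B7Prop3Flat (c3)
open B8LeafModelZd (ZdIdx)
open B8LeafModelZd3 (zdGF3)
open Node00 (Stage13Params NE3Objects₁₁ NE3Letters₁₁ NE2Objects₁₁ ne3LOfRecord₁₁ ne3ConstLayerOfRecord₁₁ ne3NperOfRecord₁₁ ne3DomOfRecord₁₁ two_le_ne3LOfRecord₁₁ MatA)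
open Node00.W1 (ReadingData)
open Summit.QuantumFields.BalabanUV.T4Continuum
open MinimalActionRate (sfClass)
open BlockAverageCurrent (curConst)
open NE3RightInverseSupLetters (frameC)
open NE3.LeafIndexSockets (LeafH3sup)
open YMDAG.UVSplit (NE3Carriers NE1pCarriers RateCarriers ne3OfRecord₁₁ rateCarriersOfRecord₁₃Sep readingOfRecord₁₃Sep)
open Summit.QuantumFields.YangMills.BalabanUVNodes.N16HolderDefs (N16HolderAt)
open Summit.QuantumFields.YangMills.BalabanUVNodes.N16HolderMSDefs (CovRootHolderMS N16HolderMSAt n16HolderAt_of_n16HolderMSAt)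
open Summit.QuantumFields.YangMills.BalabanUVNodes.N16HolderMSRegime (radiusOfRecordHMS constOfRecordHMS)
open Summit.QuantumFields.YangMills.BalabanUVNodes.N16HolderMSLeafSlot (n16HolderMSAt_of_inEndRegimeHMS_leafSlotHolderMS)
open Summit.QuantumFields.YangMills.BalabanUVNodes.N16HolderMSSlotWindow (inEndRegimeHMS_and_leafSlotHolderMS_ofRecord_of_window_linear)

noncomputable section

variable {N : ℕ} [NeZero N]
  (rr : (F : T4Family) → (θ : Stage13Params F N) → θ.Provisos₁₃Sep F N → (ℕ → ℝ) → List (ULoop F) → RateCarriers N)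
  (Rg : (F : T4Family) → Stage13Params F N → Prop) (ℓ : T4Family → NE3Letters₁₁) (β : ℝ)

/-! ## §1 `hpin`-generic: the MS β-conjunct of a tuple reading pinned at RR-1's object of record -/

section OfRecord

variable (hpin : ∀ (F : T4Family) (θ : Stage13Params F N) (hP : θ.Provisos₁₃Sep F N) (g₀ : ℕ → ℝ) (os : List (ULoop F)),
    (rr F θ hP g₀ os).ne3 = ne3OfRecord₁₁ F (ne3ConstLayerOfRecord₁₁ F N (ℓ F)))
include hpin

/-- **THE MS β-CONJUNCT OF A PINNED TUPLE READING IS ONE `N16HolderMSAt … β` PER FAMILY CARRYING AN ADMISSIBLE TUPLE WITH THE SEPARATED PROVISO** (unguarded binder shape of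
plan's `KeyedRates`). [folklore] -/
theorem n16HolderMS_tupleReading_iff_ofRecord :
    (∀ (F : T4Family) (θ : Stage13Params F N) (hP : θ.Provisos₁₃Sep F N), θ.Admissible F N →
        ∀ (g₀ : ℕ → ℝ) (os : List (ULoop F)), N16HolderMSAt (rr F θ hP g₀ os).ne3 β) ↔
      ∀ (F : T4Family), (∃ θ : Stage13Params F N, θ.Provisos₁₃Sep F N ∧ θ.Admissible F N) →
        N16HolderMSAt (ne3OfRecord₁₁ F (ne3ConstLayerOfRecord₁₁ F N (ℓ F))) β := by
  constructor
  · rintro h F ⟨θ, hP, hθ⟩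
    have h' := h F θ hP hθ (fun _ => 0) []
    rwa [hpin] at h'
  · intro h F θ hP hθ g₀ os
    rw [hpin]
    exact h F ⟨θ, hP, hθ⟩

/-- **THE SAME WITH A REGIME `Rg F θ` INSIDE THE BINDER** (rev 18's guarded prefix, e.g. RR-2's `unityNondeg₁₃`). [folklore] -/
theorem n16HolderMS_tupleReadingOn_iff_ofRecord :
    (∀ (F : T4Family) (θ : Stage13Params F N) (hP : θ.Provisos₁₃Sep F N), Rg F θ → θ.Admissible F N →
        ∀ (g₀ : ℕ → ℝ) (os : List (ULoop F)), N16HolderMSAt (rr F θ hP g₀ os).ne3 β) ↔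
      ∀ (F : T4Family), (∃ θ : Stage13Params F N, θ.Provisos₁₃Sep F N ∧ Rg F θ ∧ θ.Admissible F N) →
        N16HolderMSAt (ne3OfRecord₁₁ F (ne3ConstLayerOfRecord₁₁ F N (ℓ F))) β := by
  constructor
  · rintro h F ⟨θ, hP, hRg, hθ⟩
    have h' := h F θ hP hRg hθ (fun _ => 0) []
    rwa [hpin] at h'
  · intro h F θ hP hRg hθ g₀ os
    rw [hpin]
    exact h F ⟨θ, hP, hRg, hθ⟩

/-- **N21's MS-FACE AT THE TUPLE READING**: under the MS β-conjunct, at every family with an admissible tuple with the separated proviso the MS β-root `CovRootHolderMS` at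
RR-1's period, letters `ℓ F` and data `ne3DomOfRecord₁₁ F N 0 0` — the `h` of dag-n16-c's `N16HolderMSDefs.closeness_of_covRootHolderMS`. [folklore] -/
theorem covRootHolderMS_tupleReading_ofRecord
    (h : ∀ (F : T4Family) (θ : Stage13Params F N) (hP : θ.Provisos₁₃Sep F N), θ.Admissible F N →
      ∀ (g₀ : ℕ → ℝ) (os : List (ULoop F)), N16HolderMSAt (rr F θ hP g₀ os).ne3 β)
    (F : T4Family) {θ : Stage13Params F N} (hP : θ.Provisos₁₃Sep F N) (hθ : θ.Admissible F N) :
    CovRootHolderMS 4 (sfClass 4 (ne3LOfRecord₁₁ F) (ne3NperOfRecord₁₁ F 0 0) (ℓ F).ε) (ne3LOfRecord₁₁ F) (ne3NperOfRecord₁₁ F 0 0) (ℓ F).b (ℓ F).g (ℓ F).C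
      (ℓ F).Λ₁ (ℓ F).Λ₂' β (ne3DomOfRecord₁₁ F N 0 0) :=
  (n16HolderMS_tupleReading_iff_ofRecord rr ℓ β hpin).1 h F ⟨θ, hP, hθ⟩

/-- **MS ⇒ β AT THE TUPLE READING**: the MS β-conjunct implies the β-conjunct of module 21Sep §3 (dag-n16-c's `n16HolderAt_of_n16HolderMSAt`; the block factor
`ne3LOfRecord₁₁ F ≥ 2 ≥ 1` is RR-1's). [folklore] -/
theorem n16Holder_tupleReading_of_n16HolderMS
    (h : ∀ (F : T4Family) (θ : Stage13Params F N) (hP : θ.Provisos₁₃Sep F N), θ.Admissible F N →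
      ∀ (g₀ : ℕ → ℝ) (os : List (ULoop F)), N16HolderMSAt (rr F θ hP g₀ os).ne3 β) :
    ∀ (F : T4Family) (θ : Stage13Params F N) (hP : θ.Provisos₁₃Sep F N), θ.Admissible F N →
      ∀ (g₀ : ℕ → ℝ) (os : List (ULoop F)), N16HolderAt (rr F θ hP g₀ os).ne3 β := by
  intro F θ hP hθ g₀ os
  have hMS := h F θ hP hθ g₀ os
  rw [hpin] at hMS ⊢
  exact n16HolderAt_of_n16HolderMSAt hMS (le_trans one_le_two (two_le_ne3LOfRecord₁₁ F))

variable (hβ0 : 0 ≤ β) (hβ1 : β ≤ 1)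
  -- N05's constants, per family (MS length letter); the averaging letter in N05's window and N07's leaf letters, per family (module 26's STAGE-FREE per-family lemma, verbatim)
  {len : T4Family → Site 4 → ℝ} {c₁ c₁' B₁' cP C₂ B₀β : T4Family → ℝ} {inp : T4Family → B8.B9Inputs} {α b' c' : T4Family → ℝ}
  (hlen : ∀ (F : T4Family) (v : Site 4), 0 < len F v → 1 ≤ len F v) (hlenj : ∀ (F : T4Family) (μ : Fin 4) (j : ℕ), len F (j • e μ) = j)
  (hB₁' : ∀ F, 0 < B₁' F) (hBB : ∀ F : T4Family, 5 * ((4 : ℕ) : ℝ) * F.L * (inp F).B₀ ≤ B₁' F) (hc₁' : ∀ F, 0 < c₁' F)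
  (hwin : ∀ (F : T4Family) (α₀ α₁ : ℝ), 0 < α₀ → 0 < α₁ → α₀ + α₁ ≤ c₁' F →
    α₀ + α₁ ≤ c₁ F ∧ C0 4 * (2 * α₀) ≤ 1 / 3 ∧ 4 * α₀ ≤ c2' 4 F.L ∧ 16 * (B₁' F * (α₀ + α₁)) ≤ 1 ∧
    Real.exp (4 * (800 * (((4 : ℕ) : ℝ) + 1) ^ 2 * (((4 : ℕ) : ℝ) + 4)) * α₀) * (1 + 8 * (131072 * (((4 : ℕ) : ℝ) + 1) ^ 2) * (B₁' F * (α₀ + α₁))) ≤ 2 ∧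
    2 * (B₁' F * (α₀ + α₁)) ≤ c3 4 F.L ∧ ((4 : ℕ) : ℝ) * F.L * α₁ ≤ 1 / 8 ∧ α₀ ≤ cP F ∧ α₁ ≤ cP F ∧ B₁' F * (α₀ + α₁) ≤ cP F ∧
    2 * (B₁' F * (α₀ + α₁)) ^ 2 + 20 * ((4 : ℕ) : ℝ) * α₀ * (B₁' F * (α₀ + α₁)) + 2 * C₂ F * (B₁' F * (α₀ + α₁)) ^ 2 ≤ α₀ + α₁)
  (hα : ∀ F, 0 < α F) (hα1 : ∀ F, α F ≤ c₁' F / 177)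
  (hα2 : ∀ F : T4Family, α F ≤ (ℓ F).Λ₁ / (1770 * (5 * ((4 : ℕ) : ℝ) * F.L * (inp F).B₀) + 1))
  (hα3 : ∀ F : T4Family, α F ≤ c2' 4 F.L / 2)
  (hα4 : ∀ F : T4Family, α F ≤ 1 / ((23040 * (4 : ℝ) ^ 4 * (frameC 4 F.L + 4) ^ 3 + 12) * (1 + curConst 4 F.L) + 1))
  (hα5 : ∀ F, α F ≤ 1 / 10 ^ 9)
  (hg : ∀ F, 0 < (ℓ F).g) (hε0 : ∀ F, 0 < (ℓ F).ε) (hε : ∀ F, (ℓ F).ε < α F)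
  (hΛ₁r : ∀ F : T4Family, (ℓ F).Λ₁ ≤ radiusOfRecordHMS N F.L (ne3NperOfRecord₁₁ F 0 0))
  (hb : ∀ F, 0 ≤ (ℓ F).b ∧ (ℓ F).b ≤ (ℓ F).ε / 2) (hC : ∀ F : T4Family, constOfRecordHMS N F.L (ne3NperOfRecord₁₁ F 0 0) (ℓ F).g ≤ (ℓ F).C)
  (hΛ₂' : ∀ F : T4Family, 177 * α F * (5 * ((4 : ℕ) : ℝ) * F.L * B₀β F + 5 * ((4 : ℕ) : ℝ) * F.L * (inp F).B₀) ≤ (ℓ F).Λ₂')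
  (hb' : ∀ F, 0 ≤ b' F ∧ b' F ≤ α F / 2048) (hc' : ∀ F, 0 ≤ c' F ∧ c' F ≤ α F / 24)
include hβ0 hβ1 hlen hlenj hB₁' hBB hc₁' hwin hα hα1 hα2 hα3 hα4 hα5 hg hε0 hε hΛ₁r hb hC hΛ₂' hb' hc'

/-- ★ **THE MS N16 LINE IN THE K3⁗ CURRENCY, UNGUARDED** — for ANY tuple reading `rr` over the separated proviso pinned at RR-1's object with windowed letters `ℓ F`, the three content
clauses ONCE per family carrying an admissible tuple give the MS β-conjunct «`∀ F θ hP, θ.Admissible F N → ∀ g₀ os, N16HolderMSAt (rr F θ hP g₀ os).ne3 β`»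
(module 26's STAGE-FREE `inEndRegimeHMS_and_leafSlotHolderMS_ofRecord_of_window_linear` per family, module 25's closer). [folklore] -/
theorem n16HolderMS_tupleReading_ofRecord_of_window_linear
    (hcontent : ∀ (F : T4Family), (∃ θ : Stage13Params F N, θ.Provisos₁₃Sep F N ∧ θ.Admissible F N) →
      letI : CStarAlgebra (Matrix (Fin N) (Fin N) ℂ) := {}
      B8.Thm4Body (c₁ F) (B₁' F) (fun i : {i : ZdIdx 4 F.L // i.Ω 0 = Set.univ} => (zdGF3 (Matrix (Fin N) (Fin N) ℂ) F.L β (len F) i.1).toGFData) ∧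
        B8.Prop3Body (cP F) 4 (F.L : ℝ) (C₂ F) (inp F) (B₀β F)
          (fun i : {i : ZdIdx 4 F.L // i.Ω 0 = Set.univ} => (zdGF3 (Matrix (Fin N) (Fin N) ℂ) F.L β (len F) i.1).toGFData2) ∧
        LeafH3sup 4 F.L (ne3NperOfRecord₁₁ F 0 0) (ℓ F).ε (b' F) (c' F) (ne3DomOfRecord₁₁ F N 0 0)) :
    ∀ (F : T4Family) (θ : Stage13Params F N) (hP : θ.Provisos₁₃Sep F N), θ.Admissible F N →
      ∀ (g₀ : ℕ → ℝ) (os : List (ULoop F)), N16HolderMSAt (rr F θ hP g₀ os).ne3 β :=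
  (n16HolderMS_tupleReading_iff_ofRecord rr ℓ β hpin).2 fun F hF =>
    have h := inEndRegimeHMS_and_leafSlotHolderMS_ofRecord_of_window_linear ℓ hlen hlenj hB₁' hBB hc₁' hwin hα hα1 hα2 hα3 hα4 hα5 hg hε0 hε hΛ₁r hb hC hΛ₂' hb' hc' F
      (hcontent F hF).1 (hcontent F hF).2.1 (hcontent F hF).2.2
    n16HolderMSAt_of_inEndRegimeHMS_leafSlotHolderMS h.1 hβ0 hβ1 h.2

/-- ★ **THE MS N16 LINE IN THE K3⁗ CURRENCY, GUARDED θ-FORM** (regime `Rg F θ` inside the binder; content asked only of GUARDED families). [folklore] -/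
theorem n16HolderMS_tupleReadingOn_ofRecord_of_window_linear
    (hcontent : ∀ (F : T4Family), (∃ θ : Stage13Params F N, θ.Provisos₁₃Sep F N ∧ Rg F θ ∧ θ.Admissible F N) →
      letI : CStarAlgebra (Matrix (Fin N) (Fin N) ℂ) := {}
      B8.Thm4Body (c₁ F) (B₁' F) (fun i : {i : ZdIdx 4 F.L // i.Ω 0 = Set.univ} => (zdGF3 (Matrix (Fin N) (Fin N) ℂ) F.L β (len F) i.1).toGFData) ∧
        B8.Prop3Body (cP F) 4 (F.L : ℝ) (C₂ F) (inp F) (B₀β F)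
          (fun i : {i : ZdIdx 4 F.L // i.Ω 0 = Set.univ} => (zdGF3 (Matrix (Fin N) (Fin N) ℂ) F.L β (len F) i.1).toGFData2) ∧
        LeafH3sup 4 F.L (ne3NperOfRecord₁₁ F 0 0) (ℓ F).ε (b' F) (c' F) (ne3DomOfRecord₁₁ F N 0 0)) :
    ∀ (F : T4Family) (θ : Stage13Params F N) (hP : θ.Provisos₁₃Sep F N), Rg F θ → θ.Admissible F N →
      ∀ (g₀ : ℕ → ℝ) (os : List (ULoop F)), N16HolderMSAt (rr F θ hP g₀ os).ne3 β :=
  (n16HolderMS_tupleReadingOn_iff_ofRecord rr Rg ℓ β hpin).2 fun F hF =>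
    have h := inEndRegimeHMS_and_leafSlotHolderMS_ofRecord_of_window_linear ℓ hlen hlenj hB₁' hBB hc₁' hwin hα hα1 hα2 hα3 hα4 hα5 hg hε0 hε hΛ₁r hb hC hΛ₂' hb' hc' F
      (hcontent F hF).1 (hcontent F hF).2.1 (hcontent F hF).2.2
    n16HolderMSAt_of_inEndRegimeHMS_leafSlotHolderMS h.1 hβ0 hβ1 h.2

end OfRecord

/-! ## §2 At the LEVEL-SELECTED tuple reading of dag-n22-e's ⁗ reading of record (`hpin := rfl`) -/

section NamedReading

variable (w1 : (F : T4Family) → (θ : Stage13Params F N) → ReadingData F (MatA N) θ.τ9.M)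
  (ne2 : (F : T4Family) → Stage13Params F N → (ℕ → ℝ) → List (ULoop F) → ℕ → NE2Objects₁₁)
  (ne1 : (F : T4Family) → Stage13Params F N → (ℕ → ℝ) → List (ULoop F) → NE1pCarriers)
  (ksel : (F : T4Family) → Stage13Params F N → (ℕ → ℝ) → List (ULoop F) → ℕ)

/-- **THE MS β-CONJUNCT AT THE LEVEL-SELECTED TUPLE READING OF RECORD IS ONE `N16HolderMSAt … β` PER FAMILY CARRYING AN ADMISSIBLE TUPLE**
(`rr F θ hP g₀ os := rateCarriersOfRecord₁₃Sep (readingOfRecord₁₃Sep w1 ℓ ne2 ne1) F θ hP g₀ os (ksel F θ g₀ os)`; the component by `rfl`). [folklore] -/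
theorem n16HolderMS_tupleReadingOfRecordSep_iff :
    (∀ (F : T4Family) (θ : Stage13Params F N) (hP : θ.Provisos₁₃Sep F N), θ.Admissible F N → ∀ (g₀ : ℕ → ℝ) (os : List (ULoop F)),
        N16HolderMSAt (rateCarriersOfRecord₁₃Sep (readingOfRecord₁₃Sep w1 ℓ ne2 ne1) F θ hP g₀ os (ksel F θ g₀ os)).ne3 β) ↔
      ∀ (F : T4Family), (∃ θ : Stage13Params F N, θ.Provisos₁₃Sep F N ∧ θ.Admissible F N) →
        N16HolderMSAt (ne3OfRecord₁₁ F (ne3ConstLayerOfRecord₁₁ F N (ℓ F))) β :=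
  n16HolderMS_tupleReading_iff_ofRecord (fun F θ hP g₀ os => rateCarriersOfRecord₁₃Sep (readingOfRecord₁₃Sep w1 ℓ ne2 ne1) F θ hP g₀ os (ksel F θ g₀ os)) ℓ β
    fun _ _ _ _ _ => rfl

/-- **… AND GUARDED** (regime `Rg F θ` inside the binder). [folklore] -/
theorem n16HolderMS_tupleReadingOfRecordSepOn_iff :
    (∀ (F : T4Family) (θ : Stage13Params F N) (hP : θ.Provisos₁₃Sep F N), Rg F θ → θ.Admissible F N → ∀ (g₀ : ℕ → ℝ) (os : List (ULoop F)),
        N16HolderMSAt (rateCarriersOfRecord₁₃Sep (readingOfRecord₁₃Sep w1 ℓ ne2 ne1) F θ hP g₀ os (ksel F θ g₀ os)).ne3 β) ↔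
      ∀ (F : T4Family), (∃ θ : Stage13Params F N, θ.Provisos₁₃Sep F N ∧ Rg F θ ∧ θ.Admissible F N) →
        N16HolderMSAt (ne3OfRecord₁₁ F (ne3ConstLayerOfRecord₁₁ F N (ℓ F))) β :=
  n16HolderMS_tupleReadingOn_iff_ofRecord (fun F θ hP g₀ os => rateCarriersOfRecord₁₃Sep (readingOfRecord₁₃Sep w1 ℓ ne2 ne1) F θ hP g₀ os (ksel F θ g₀ os)) Rg ℓ β
    fun _ _ _ _ _ => rfl

variable {β} (hβ0 : 0 ≤ β) (hβ1 : β ≤ 1)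
  {len : T4Family → Site 4 → ℝ} {c₁ c₁' B₁' cP C₂ B₀β : T4Family → ℝ} {inp : T4Family → B8.B9Inputs} {α b' c' : T4Family → ℝ}
  (hlen : ∀ (F : T4Family) (v : Site 4), 0 < len F v → 1 ≤ len F v) (hlenj : ∀ (F : T4Family) (μ : Fin 4) (j : ℕ), len F (j • e μ) = j)
  (hB₁' : ∀ F, 0 < B₁' F) (hBB : ∀ F : T4Family, 5 * ((4 : ℕ) : ℝ) * F.L * (inp F).B₀ ≤ B₁' F) (hc₁' : ∀ F, 0 < c₁' F)
  (hwin : ∀ (F : T4Family) (α₀ α₁ : ℝ), 0 < α₀ → 0 < α₁ → α₀ + α₁ ≤ c₁' F →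
    α₀ + α₁ ≤ c₁ F ∧ C0 4 * (2 * α₀) ≤ 1 / 3 ∧ 4 * α₀ ≤ c2' 4 F.L ∧ 16 * (B₁' F * (α₀ + α₁)) ≤ 1 ∧
    Real.exp (4 * (800 * (((4 : ℕ) : ℝ) + 1) ^ 2 * (((4 : ℕ) : ℝ) + 4)) * α₀) * (1 + 8 * (131072 * (((4 : ℕ) : ℝ) + 1) ^ 2) * (B₁' F * (α₀ + α₁))) ≤ 2 ∧
    2 * (B₁' F * (α₀ + α₁)) ≤ c3 4 F.L ∧ ((4 : ℕ) : ℝ) * F.L * α₁ ≤ 1 / 8 ∧ α₀ ≤ cP F ∧ α₁ ≤ cP F ∧ B₁' F * (α₀ + α₁) ≤ cP F ∧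
    2 * (B₁' F * (α₀ + α₁)) ^ 2 + 20 * ((4 : ℕ) : ℝ) * α₀ * (B₁' F * (α₀ + α₁)) + 2 * C₂ F * (B₁' F * (α₀ + α₁)) ^ 2 ≤ α₀ + α₁)
  (hα : ∀ F, 0 < α F) (hα1 : ∀ F, α F ≤ c₁' F / 177)
  (hα2 : ∀ F : T4Family, α F ≤ (ℓ F).Λ₁ / (1770 * (5 * ((4 : ℕ) : ℝ) * F.L * (inp F).B₀) + 1))
  (hα3 : ∀ F : T4Family, α F ≤ c2' 4 F.L / 2)
  (hα4 : ∀ F : T4Family, α F ≤ 1 / ((23040 * (4 : ℝ) ^ 4 * (frameC 4 F.L + 4) ^ 3 + 12) * (1 + curConst 4 F.L) + 1))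
  (hα5 : ∀ F, α F ≤ 1 / 10 ^ 9)
  (hg : ∀ F, 0 < (ℓ F).g) (hε0 : ∀ F, 0 < (ℓ F).ε) (hε : ∀ F, (ℓ F).ε < α F)
  (hΛ₁r : ∀ F : T4Family, (ℓ F).Λ₁ ≤ radiusOfRecordHMS N F.L (ne3NperOfRecord₁₁ F 0 0))
  (hb : ∀ F, 0 ≤ (ℓ F).b ∧ (ℓ F).b ≤ (ℓ F).ε / 2) (hC : ∀ F : T4Family, constOfRecordHMS N F.L (ne3NperOfRecord₁₁ F 0 0) (ℓ F).g ≤ (ℓ F).C)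
  (hΛ₂' : ∀ F : T4Family, 177 * α F * (5 * ((4 : ℕ) : ℝ) * F.L * B₀β F + 5 * ((4 : ℕ) : ℝ) * F.L * (inp F).B₀) ≤ (ℓ F).Λ₂')
  (hb' : ∀ F, 0 ≤ b' F ∧ b' F ≤ α F / 2048) (hc' : ∀ F, 0 ≤ c' F ∧ c' F ≤ α F / 24)
include hβ0 hβ1 hlen hlenj hB₁' hBB hc₁' hwin hα hα1 hα2 hα3 hα4 hα5 hg hε0 hε hΛ₁r hb hC hΛ₂' hb' hc'

/-- ★ **THE MS N16 LINE AT THE LEVEL-SELECTED TUPLE READING OF RECORD, GUARDED** — the content once per guarded family gives rev 18's binder at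
`rr := rateCarriersOfRecord₁₃Sep (readingOfRecord₁₃Sep w1 ℓ ne2 ne1) · · · · · (ksel …)` (§1 at `rfl`; the composer conjoins it with the other five nodes' conjuncts at the same `rr`).
[folklore] -/
theorem n16HolderMS_tupleReadingOfRecordSepOn_of_window_linear
    (hcontent : ∀ (F : T4Family), (∃ θ : Stage13Params F N, θ.Provisos₁₃Sep F N ∧ Rg F θ ∧ θ.Admissible F N) →
      letI : CStarAlgebra (Matrix (Fin N) (Fin N) ℂ) := {}
      B8.Thm4Body (c₁ F) (B₁' F) (fun i : {i : ZdIdx 4 F.L // i.Ω 0 = Set.univ} => (zdGF3 (Matrix (Fin N) (Fin N) ℂ) F.L β (len F) i.1).toGFData) ∧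
        B8.Prop3Body (cP F) 4 (F.L : ℝ) (C₂ F) (inp F) (B₀β F)
          (fun i : {i : ZdIdx 4 F.L // i.Ω 0 = Set.univ} => (zdGF3 (Matrix (Fin N) (Fin N) ℂ) F.L β (len F) i.1).toGFData2) ∧
        LeafH3sup 4 F.L (ne3NperOfRecord₁₁ F 0 0) (ℓ F).ε (b' F) (c' F) (ne3DomOfRecord₁₁ F N 0 0)) :
    ∀ (F : T4Family) (θ : Stage13Params F N) (hP : θ.Provisos₁₃Sep F N), Rg F θ → θ.Admissible F N → ∀ (g₀ : ℕ → ℝ) (os : List (ULoop F)),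
      N16HolderMSAt (rateCarriersOfRecord₁₃Sep (readingOfRecord₁₃Sep w1 ℓ ne2 ne1) F θ hP g₀ os (ksel F θ g₀ os)).ne3 β :=
  n16HolderMS_tupleReadingOn_ofRecord_of_window_linear (fun F θ hP g₀ os => rateCarriersOfRecord₁₃Sep (readingOfRecord₁₃Sep w1 ℓ ne2 ne1) F θ hP g₀ os (ksel F θ g₀ os))
    Rg ℓ β (fun _ _ _ _ _ => rfl) hβ0 hβ1 hlen hlenj hB₁' hBB hc₁' hwin hα hα1 hα2 hα3 hα4 hα5 hg hε0 hε hΛ₁r hb hC hΛ₂' hb' hc' hcontent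

end NamedReading

end

end Summit.QuantumFields.YangMills.BalabanUVNodes.N16HolderMSAtTupleReading13Sep
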